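import Mathlib
import HarnessLib

/-!
# Determinant identities of an affine simplex: cone decomposition, translation of a cone,
# boundary of a boundary (helper toward `stub_rung_flatObstructed`, crux `TropicalWeilVanishing`)

Route `TropicalWeilObstruction` of `HodgeConjecture`, crux item stmt-HodgeConjecture-18478, line
`identity_transfer`, registered stub `stub_rung_flatObstructed`. The stub's proof runs Kontsevich's
"discrete Stokes" bookkeeping on the closedness certificate of an effective tropical cycle
(`Literature.AlgebraicGeometry.Tropical.TorusCycles`): the volume vector of every cell is the
alternating sum of the cones over its facets, a translated cone differs from the cone by an apex
term, and the apex terms of the facets of one cell cancel. In Plücker coordinates all three are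
identities between determinants of small matrices built from the (coordinate-restricted) vertices;
this file proves them over any commutative ring, for simplices of every dimension, from Laplace
expansion along a column of ones (`Matrix.det_succ_column_zero`), elementary row operations
(`Matrix.det_eq_of_forall_row_eq_smul_add_const`) and `Matrix.det_permute`. Rows of `Matrix.of x` are
the vectors `x k`.

* `det_affine_eq_det_sub`, `det_affine_eq_sum`, `sum_sign_det_succAbove` — the affine volume
  `det [1 | x_k] = det [x_{j+1} - x_0] = Σ_i (-1)^i det [x_k]_{k ≠ i}` (**cone decomposition**);
* `det_sub_perm`, `det_of_perm`, `det_cons_sub_perm` — reordering the points / vectors multiplies by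
  the sign of the permutation;
* `det_sub_add_const`, `det_of_cons_sub`, `det_add_const`, `det_cons_add` — **translation of a cone**
  `det [r_j + u] = det [r_j] + det [u; r_{j+1} - r_0]` and linearity in the apex row;
* `det_apex_affine`, `sum_sign_det_apex_face` — **boundary of a boundary**
  `Σ_i (-1)^i det [u; (x∘δ_i)_{j+1} - (x∘δ_i)_0] = 0`.

Mathlib-only; no definition, no named fact, no sorry.
-/

-- `Summit.HodgeConjecture.HodgeConjecture.…` is the mandated namespace (single-conjunct summit).
set_option linter.dupNamespace false

open scoped BigOperators
open Matrix

namespace Summit.HodgeConjecture.HodgeConjecture.Theorems.TropicalWeilVanishing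

variable {R : Type*} [CommRing R] {m q : ℕ}

/-- `det [1 | x_k]_k = det [x_{j+1} - x_0]_j`: the affine volume of `m+1` points of `Rᵐ`. [folklore] -/
theorem det_affine_eq_det_sub (x : Fin (m + 1) → Fin m → R) :
    (Matrix.of fun k : Fin (m + 1) => (Fin.cons 1 (x k) : Fin (m + 1) → R)).det =
      (Matrix.of fun j : Fin m => x j.succ - x 0).det := by
  set A : Matrix (Fin (m + 1)) (Fin (m + 1)) R := Matrix.of fun k => Fin.cons 1 (x k) with hA
  set B : Matrix (Fin (m + 1)) (Fin (m + 1)) R :=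
    Matrix.of (Fin.cons (Fin.cons 1 (x 0)) fun j => Fin.cons 0 (x j.succ - x 0)) with hB
  have hAB : A.det = B.det := by
    refine Matrix.det_eq_of_forall_row_eq_smul_add_const (Fin.cons 0 fun _ => 1) 0 (by simp) ?_
    intro i j
    refine Fin.cases ?_ (fun i' => ?_) i
    · simp [hA, hB]
    · refine Fin.cases ?_ (fun j' => ?_) j
      · simp [hA, hB]
      · simp [hA, hB]
  rw [hAB, Matrix.det_succ_column_zero, Fin.sum_univ_succ]
  have h0 : ∀ i : Fin m, B i.succ 0 = 0 := fun i => by simp [hB]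
  simp only [h0, mul_zero, zero_mul, Finset.sum_const_zero, add_zero]
  have hB00 : B 0 0 = 1 := by simp [hB]
  rw [hB00]
  simp only [Fin.val_zero, pow_zero, one_mul]
  rfl

/-- Laplace along the column of ones: `det [1 | x_k]_k = Σ_i (-1)^i det [x_k]_{k ≠ i}`. [folklore] -/
theorem det_affine_eq_sum (x : Fin (m + 1) → Fin m → R) :
    (Matrix.of fun k : Fin (m + 1) => (Fin.cons 1 (x k) : Fin (m + 1) → R)).det =
      ∑ i : Fin (m + 1), (-1) ^ (i : ℕ) * (Matrix.of fun j : Fin m => x (i.succAbove j)).det := by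
  rw [Matrix.det_succ_column_zero]
  refine Finset.sum_congr rfl fun i _ => ?_
  have h1 : (Matrix.of fun k : Fin (m + 1) => (Fin.cons 1 (x k) : Fin (m + 1) → R)) i 0 = 1 := by
    simp
  rw [h1, mul_one]
  congr 2

/-- **Cone decomposition** of the volume vector of a simplex:
`Σ_i (-1)^i det [x_k]_{k ≠ i} = det [x_{j+1} - x_0]_j`. [folklore] -/
theorem sum_sign_det_succAbove (x : Fin (m + 1) → Fin m → R) :
    ∑ i : Fin (m + 1), (-1) ^ (i : ℕ) * (Matrix.of fun j : Fin m => x (i.succAbove j)).det =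
      (Matrix.of fun j : Fin m => x j.succ - x 0).det := by
  rw [← det_affine_eq_sum, det_affine_eq_det_sub]

/-- Permuting the points multiplies the affine volume by the sign. [folklore] -/
theorem det_sub_perm (x : Fin (m + 1) → Fin m → R) (π : Equiv.Perm (Fin (m + 1))) :
    (Matrix.of fun j : Fin m => x (π j.succ) - x (π 0)).det =
      ((Equiv.Perm.sign π : ℤˣ) : ℤ) * (Matrix.of fun j : Fin m => x j.succ - x 0).det := by
  have h1 := det_affine_eq_det_sub (fun k => x (π k))
  have h2 := det_affine_eq_det_sub x
  rw [← h1, ← h2]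
  have : (Matrix.of fun k : Fin (m + 1) => (Fin.cons 1 (x (π k)) : Fin (m + 1) → R)) =
      (Matrix.of fun k : Fin (m + 1) => (Fin.cons 1 (x k) : Fin (m + 1) → R)).submatrix π id := by
    ext k j
    simp
  rw [this, Matrix.det_permute]

/-- Permuting the vectors multiplies the volume vector by the sign. [folklore] -/
theorem det_of_perm (y : Fin m → Fin m → R) (π : Equiv.Perm (Fin m)) :
    (Matrix.of fun j => y (π j)).det = ((Equiv.Perm.sign π : ℤˣ) : ℤ) * (Matrix.of y).det := by
  have : (Matrix.of fun j => y (π j)) = (Matrix.of y).submatrix π id := by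
    ext k j; simp
  rw [this, Matrix.det_permute]

/-- Translation invariance of the affine volume. [folklore] -/
theorem det_sub_add_const (x : Fin (m + 1) → Fin m → R) (u : Fin m → R) :
    (Matrix.of fun j : Fin m => (x j.succ + u) - (x 0 + u)).det =
      (Matrix.of fun j : Fin m => x j.succ - x 0).det := by
  congr 2
  ext j a
  simp

/-- Adding row `0` to every other row does not change the determinant. [folklore] -/
theorem det_of_cons_sub (r₀ : Fin (q + 1) → R) (y : Fin q → Fin (q + 1) → R) :
    (Matrix.of (Fin.cons r₀ fun j => y j - r₀ : Fin (q + 1) → Fin (q + 1) → R)).det =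
      (Matrix.of (Fin.cons r₀ y : Fin (q + 1) → Fin (q + 1) → R)).det := by
  symm
  refine Matrix.det_eq_of_forall_row_eq_smul_add_const (Fin.cons 0 fun _ => 1) 0 (by simp) ?_
  intro i j
  refine Fin.cases ?_ (fun i' => ?_) i
  · simp
  · simp

/-- **Translation of a cone**: `det [r_j + u]_j = det [r_j]_j + det [u; r_{j+1} - r_0]`
(`q + 1` vectors). [folklore] -/
theorem det_add_const (r : Fin (q + 1) → Fin (q + 1) → R) (u : Fin (q + 1) → R) :
    (Matrix.of fun j => r j + u).det =
      (Matrix.of r).det + (Matrix.of (Fin.cons u fun j : Fin q => r j.succ - r 0)).det := by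
  -- subtract row `0` from the other rows
  have h1 : (Matrix.of fun j => r j + u).det =
      (Matrix.of (Fin.cons (r 0 + u) fun j : Fin q => r j.succ - r 0 :
        Fin (q + 1) → Fin (q + 1) → R)).det := by
    have := det_of_cons_sub (r 0 + u) (fun j : Fin q => r j.succ + u)
    have e : (Fin.cons (r 0 + u) fun j : Fin q => r j.succ + u : Fin (q + 1) → Fin (q + 1) → R) =
        fun j => r j + u := by
      ext j a
      refine Fin.cases ?_ (fun j' => ?_) j <;> simp
    rw [e] at this
    rw [← this]
    congr 2
    ext j a
    refine Fin.cases ?_ (fun j' => ?_) j <;> simp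
  -- linearity in row `0`
  have h2 : (Matrix.of (Fin.cons (r 0 + u) fun j : Fin q => r j.succ - r 0 :
        Fin (q + 1) → Fin (q + 1) → R)).det =
      (Matrix.of (Fin.cons (r 0) fun j : Fin q => r j.succ - r 0 : Fin (q + 1) → Fin (q + 1) → R)).det +
      (Matrix.of (Fin.cons u fun j : Fin q => r j.succ - r 0 : Fin (q + 1) → Fin (q + 1) → R)).det := by
    have := Matrix.det_updateRow_add
      (Matrix.of (Fin.cons (r 0) fun j : Fin q => r j.succ - r 0 : Fin (q + 1) → Fin (q + 1) → R))
      0 (r 0) u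
    have e1 : ∀ w : Fin (q + 1) → R, Matrix.updateRow
        (Matrix.of (Fin.cons (r 0) fun j : Fin q => r j.succ - r 0 : Fin (q + 1) → Fin (q + 1) → R)) 0 w =
        Matrix.of (Fin.cons w fun j : Fin q => r j.succ - r 0 : Fin (q + 1) → Fin (q + 1) → R) := by
      intro w
      ext i a
      refine Fin.cases ?_ (fun i' => ?_) i
      · simp
      · simp
    rw [e1, e1, e1] at this
    exact this
  -- add row `0` back
  have h3 : (Matrix.of (Fin.cons (r 0) fun j : Fin q => r j.succ - r 0 : Fin (q + 1) → Fin (q + 1) → R)).det =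
      (Matrix.of r).det := by
    rw [det_of_cons_sub]
    congr 2
    ext j a
    refine Fin.cases ?_ (fun j' => ?_) j <;> simp
  rw [h1, h2, h3]

/-- Apex over an affine simplex: `det [[0, u], [1, t_0], …, [1, t_q]] = - det [u; t_{j+1} - t_0]`. [folklore] -/
theorem det_apex_affine (u : Fin (q + 1) → R) (t : Fin (q + 1) → Fin (q + 1) → R) :
    (Matrix.of (Fin.cons (Fin.cons 0 u) fun k => Fin.cons 1 (t k) :
        Fin (q + 2) → Fin (q + 2) → R)).det =
      -(Matrix.of (Fin.cons u fun j : Fin q => t j.succ - t 0 :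
        Fin (q + 1) → Fin (q + 1) → R)).det := by
  set A : Matrix (Fin (q + 2)) (Fin (q + 2)) R :=
    Matrix.of (Fin.cons (Fin.cons 0 u) fun k => Fin.cons 1 (t k)) with hA
  set B : Matrix (Fin (q + 2)) (Fin (q + 2)) R :=
    Matrix.of (Fin.cons (Fin.cons 0 u) (Fin.cons (Fin.cons 1 (t 0))
      fun k : Fin q => Fin.cons 0 (t k.succ - t 0))) with hB
  have hAB : A.det = B.det := by
    refine Matrix.det_eq_of_forall_row_eq_smul_add_const
      (Fin.cons 0 (Fin.cons 0 fun _ => 1)) 1 (by simp) ?_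
    intro i j
    refine Fin.cases ?_ (fun i' => ?_) i
    · simp [hA, hB]
    · refine Fin.cases ?_ (fun i'' => ?_) i'
      · simp [hA, hB]
      · refine Fin.cases ?_ (fun j' => ?_) j
        · simp [hA, hB]
        · simp [hA, hB]
  rw [hAB, Matrix.det_succ_column_zero, Fin.sum_univ_succ, Fin.sum_univ_succ]
  have hB00 : B 0 0 = 0 := by simp [hB]
  have hB10 : B (Fin.succ 0) 0 = 1 := by simp [hB]
  have hBk0 : ∀ k : Fin q, B k.succ.succ 0 = 0 := fun k => by simp [hB]
  simp only [hB00, hBk0, hB10, mul_zero, zero_mul, Finset.sum_const_zero, add_zero, zero_add,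
    mul_one, Fin.val_succ, Fin.val_zero, zero_add, pow_one, neg_one_mul]
  congr 2
  ext j a
  refine Fin.cases ?_ (fun j' => ?_) j
  · simp [hB, Matrix.submatrix]
  · simp [hB, Matrix.submatrix]

/-- **Boundary of a boundary**: `Σ_i (-1)^i det [u; (x ∘ δ_i)_{k+1} - (x ∘ δ_i)_0] = 0` for `q + 2`
points `x` and an apex vector `u` (the `(q+3) × (q+3)` matrix `[[0,0,u],[1,1,x_k]_k]` has two equal
columns; expand along the first). [folklore] -/
theorem sum_sign_det_apex_face (u : Fin (q + 1) → R) (x : Fin (q + 2) → Fin (q + 1) → R) :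
    ∑ i : Fin (q + 2), (-1) ^ (i : ℕ) *
      (Matrix.of (Fin.cons u fun j : Fin q => x (i.succAbove j.succ) - x (i.succAbove 0) :
        Fin (q + 1) → Fin (q + 1) → R)).det = 0 := by
  set N : Matrix (Fin (q + 3)) (Fin (q + 3)) R :=
    Matrix.of (Fin.cons (Fin.cons 0 (Fin.cons 0 u)) fun k => Fin.cons 1 (Fin.cons 1 (x k))) with hN
  have hN0 : N.det = 0 := by
    refine Matrix.det_zero_of_column_eq (i := 0) (j := 1) (by simp) fun k => ?_
    refine Fin.cases ?_ (fun k' => ?_) k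
    · simp [hN]
    · simp [hN]
  rw [Matrix.det_succ_column_zero, Fin.sum_univ_succ] at hN0
  have h00 : N 0 0 = 0 := by simp [hN]
  have hk0 : ∀ i : Fin (q + 2), N i.succ 0 = 1 := fun i => by simp [hN]
  simp only [h00, mul_zero, zero_mul, zero_add, hk0, mul_one] at hN0
  have hminor : ∀ i : Fin (q + 2), (N.submatrix i.succ.succAbove Fin.succ).det =
      -(Matrix.of (Fin.cons u fun j : Fin q => x (i.succAbove j.succ) - x (i.succAbove 0) :
        Fin (q + 1) → Fin (q + 1) → R)).det := by
    intro i
    rw [← det_apex_affine u (fun j => x (i.succAbove j))]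
    congr 1
    ext r c
    refine Fin.cases ?_ (fun r' => ?_) r
    · simp [hN, Matrix.submatrix]
    · simp [hN, Matrix.submatrix, Fin.succ_succAbove_succ]
  simp only [hminor, Fin.val_succ, pow_succ, mul_neg] at hN0
  rw [← hN0]
  refine Finset.sum_congr rfl fun i _ => ?_
  ring

/-- Linearity of the determinant in the apex row. [folklore] -/
theorem det_cons_add (c d : Fin (q + 1) → R) (rest : Fin q → Fin (q + 1) → R) :
    (Matrix.of (Fin.cons (c + d) rest : Fin (q + 1) → Fin (q + 1) → R)).det =
      (Matrix.of (Fin.cons c rest : Fin (q + 1) → Fin (q + 1) → R)).det +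
        (Matrix.of (Fin.cons d rest : Fin (q + 1) → Fin (q + 1) → R)).det := by
  have e1 : ∀ w : Fin (q + 1) → R, Matrix.updateRow
      (Matrix.of (Fin.cons c rest : Fin (q + 1) → Fin (q + 1) → R)) 0 w =
      Matrix.of (Fin.cons w rest : Fin (q + 1) → Fin (q + 1) → R) := by
    intro w
    ext i a
    refine Fin.cases ?_ (fun i' => ?_) i
    · simp
    · simp
  have := Matrix.det_updateRow_add (Matrix.of (Fin.cons c rest : Fin (q + 1) → Fin (q + 1) → R)) 0 c d
  rwa [e1, e1, e1] at this

/-- Permuting the `q + 1` base points of an apex determinant multiplies it by the sign. [folklore] -/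
theorem det_cons_sub_perm (d : Fin (q + 1) → R) (t : Fin (q + 1) → Fin (q + 1) → R)
    (π : Equiv.Perm (Fin (q + 1))) :
    (Matrix.of (Fin.cons d fun j : Fin q => t (π j.succ) - t (π 0) :
        Fin (q + 1) → Fin (q + 1) → R)).det =
      ((Equiv.Perm.sign π : ℤˣ) : ℤ) *
        (Matrix.of (Fin.cons d fun j : Fin q => t j.succ - t 0 : Fin (q + 1) → Fin (q + 1) → R)).det := by
  have h1 := det_apex_affine d (fun k => t (π k))
  have h2 := det_apex_affine d t
  rw [← neg_inj, ← h1, neg_mul_eq_mul_neg, ← h2]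
  set π' : Equiv.Perm (Fin (q + 2)) := Equiv.Perm.decomposeFin.symm (0, π) with hπ'
  have hsub : (Matrix.of (Fin.cons (Fin.cons 0 d) fun k => Fin.cons 1 (t (π k)) :
        Fin (q + 2) → Fin (q + 2) → R)) =
      (Matrix.of (Fin.cons (Fin.cons 0 d) fun k => Fin.cons 1 (t k) :
        Fin (q + 2) → Fin (q + 2) → R)).submatrix π' id := by
    ext k a
    refine Fin.cases ?_ (fun k' => ?_) k
    · simp [hπ']
    · simp [hπ']
  rw [hsub, Matrix.det_permute, hπ', Equiv.Perm.decomposeFin.symm_sign]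
  simp

end Summit.HodgeConjecture.HodgeConjecture.Theorems.TropicalWeilVanishing
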